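import Mathlib
import Summits.MatrixMultiplication.MatrixMultiplication.Theses.FourierTwoFamiliesModP
import Summits.MatrixMultiplication.MatrixMultiplication.Theorems.PrimeTwoFamilies.Negative.Slices
import Summits.MatrixMultiplication.MatrixMultiplication.Theorems.FourierTwoFamiliesModPCyclicReductionTransfer
import Summits.MatrixMultiplication.MatrixMultiplication.Theorems.FourierTwoFamiliesModPPrimeTwoFamiliesCapacityLift

/-!
# Crux `PrimeTwoFamilies` (stmt-MatrixMultiplication-14308), line `Sketch` — stub `stub_capacityTransfer`,
# explicit / elementary route (siege k22)

Capacity gadgets (a zero-error code `W ⊆ (Fin L → Fin r)` over a gadget of direct pairs `(P c, Q c)` in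
`ℤ/m`, `|W| ≥ (m^L)^{1/2-ε}`, co-volumes `|P c||Q c| ≥ m^{1-ε}`) give every slice `0 < δ ≤ 1` of the crux
(`PrimeTwoFamiliesAt δ`: arbitrarily large `n`, a prime `p ≤ n^{2+δ}`, `n` SDPP pairs in `ℤ/p` of co-volume
`≥ n^{2-δ}`).

This file gives an independent proof with ALL PARAMETERS EXPLICIT and chosen in advance of the Bertrand
prime (the registered stub was first served by the lead's bookkeeping `n = max n₀ ⌈p^{1/(2+δ)}⌉₊` with
`∃`-thresholds; here nothing depends on `p`):

* `ε := δ/16`;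
* gadget level `m ≥ max (n₀³) ⌈6^{16/δ}⌉₊`, i.e. `n₀ ≤ m^{1/3}` and `6 ≤ m^{δ/16}`;
* number of pairs kept `n := ⌈(m^L)^θ⌉₊` with `θ := (1 + δ/16)/(2 + δ) ∈ [1/3, 1/2 - δ/8]`.

With `M := m^L` the four bookkeeping inequalities are one-line exponent comparisons
(`capacityTransferK22_bookkeeping`): `p ≤ 2·3^L·M ≤ 6^L·M ≤ M^{1+ε} = (M^θ)^{2+δ} ≤ n^{2+δ}`;
`n ≤ 2M^θ ≤ M^{δ/16}·M^θ ≤ M^{1/2-ε} ≤ |W|`; `n^{2-δ} ≤ M^{(1/2-ε)(2-δ)} ≤ M^{1-ε} = (m^{1-ε})^L`;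
`n₀ ≤ m^{1/3} ≤ m^θ ≤ M^θ ≤ n`.  The stub then lifts the code (tree `CapacityLift.codeLift`), moves the
`|W|` blocks into a prime `p ≤ 2·3^L·m^L` with sizes kept (tree `Theorems.exists_prime_sdpp_of_addEquiv`,
`k = L` factors `ℤ/m`) and keeps the first `n` blocks.

Helper file landed `--supports stmt-MatrixMultiplication-14308`; the final statement is the registered stub
signature verbatim; no new definitions.
-/

-- single-conjunct summit: the mandated namespace repeats `MatrixMultiplication`.
set_option linter.dupNamespace false

namespace Summit.MatrixMultiplication.MatrixMultiplication.Theorems.PrimeTwoFamilies.CapacityTransferK22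

open Finset
open Summit.MatrixMultiplication.MatrixMultiplication.Theses
open Summit.MatrixMultiplication.MatrixMultiplication.Theorems
open Summit.MatrixMultiplication.MatrixMultiplication.Theorems.PrimeTwoFamilies.Negative
open Summit.MatrixMultiplication.MatrixMultiplication.Theorems.PrimeTwoFamilies.CapacityLift (codeLift)
open Literature.Computability.AlgebraicComplexity

/-! ## Explicit bookkeeping -/

/-- The explicit exponent `θ = (1 + δ/16)/(2 + δ)` lies in `[1/3, 1/2 - δ/8]` for `0 < δ ≤ 1`. -/
theorem capacityTransferK22_theta_bounds {δ : ℝ} (hδ : 0 < δ) (hδ1 : δ ≤ 1) :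
    1 / 3 ≤ (1 + δ / 16) / (2 + δ) ∧ (1 + δ / 16) / (2 + δ) ≤ 1 / 2 - δ / 8 := by
  have h2δ : (0 : ℝ) < 2 + δ := by linarith
  constructor
  · rw [le_div_iff₀ h2δ]
    nlinarith
  · rw [div_le_iff₀ h2δ]
    nlinarith

/-- **Explicit bookkeeping, uniform in the word length.**  Let `0 < δ ≤ 1`, `n₀³ ≤ m`, `6 ≤ m^{δ/16}`,
`L ≥ 1`, a code size `N ≥ (m^L)^{1/2-δ/16}` and a host size `p ≤ 2·3^L·m^L`.  Then the explicit number
`n = ⌈(m^L)^θ⌉₊`, `θ = (1 + δ/16)/(2 + δ)`, satisfies `n₀ ≤ n ≤ N`, `p ≤ n^{2+δ}` and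
`n^{2-δ} ≤ (m^{1-δ/16})^L`. -/
theorem capacityTransferK22_bookkeeping {δ : ℝ} (hδ : 0 < δ) (hδ1 : δ ≤ 1) {n₀ m L N p n : ℕ}
    (hm₀ : n₀ ^ 3 ≤ m) (hm6 : (6 : ℝ) ≤ (m : ℝ) ^ (δ / 16)) (hL : 1 ≤ L)
    (hN : ((m : ℝ) ^ (L : ℝ)) ^ (1 / 2 - δ / 16) ≤ (N : ℝ)) (hp : p ≤ 2 * (3 ^ L * m ^ L))
    (hn : n = ⌈((m : ℝ) ^ L) ^ ((1 + δ / 16) / (2 + δ))⌉₊) :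
    n₀ ≤ n ∧ n ≤ N ∧ (p : ℝ) ≤ (n : ℝ) ^ (2 + δ) ∧
      (n : ℝ) ^ (2 - δ) ≤ ((m : ℝ) ^ (1 - δ / 16)) ^ L := by
  have h2δ : (0 : ℝ) < 2 + δ := by linarith
  obtain ⟨hθ3, hθ2⟩ := capacityTransferK22_theta_bounds hδ hδ1
  set θ : ℝ := (1 + δ / 16) / (2 + δ) with hθ
  have hθ0 : 0 < θ := by positivity
  -- `m ≥ 1` (as `6 ≤ m ^ (δ/16)` rules out `m = 0`)
  have hm1 : 1 ≤ m := by
    rcases Nat.eq_zero_or_pos m with h0 | h0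
    · exfalso
      rw [h0, Nat.cast_zero, Real.zero_rpow (by positivity)] at hm6
      linarith
    · exact h0
  have hm1R : (1 : ℝ) ≤ m := by exact_mod_cast hm1
  have hm0R : (0 : ℝ) ≤ m := zero_le_one.trans hm1R
  -- the real host size `M = m ^ L ≥ m ≥ 1`
  set M : ℝ := (m : ℝ) ^ L with hM
  have hmM : (m : ℝ) ≤ M := le_self_pow₀ hm1R (by omega)
  have hM1 : 1 ≤ M := hm1R.trans hmM
  have hM0 : 0 < M := one_pos.trans_le hM1
  -- the kept number `n = ⌈M ^ θ⌉₊`: `M ^ θ ≤ n ≤ 2 M ^ θ`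
  have hnlo : M ^ θ ≤ n := by rw [hn]; exact Nat.le_ceil _
  have hnhi : (n : ℝ) ≤ 2 * M ^ θ := by
    have h1 : (n : ℝ) < M ^ θ + 1 := by
      rw [hn]; exact Nat.ceil_lt_add_one (Real.rpow_nonneg hM0.le _)
    have h2 : (1 : ℝ) ≤ M ^ θ := Real.one_le_rpow hM1 hθ0.le
    linarith
  -- `2 ≤ 6 ≤ m ^ (δ/16) ≤ M ^ (δ/16) ≤ M ^ (1/2 - δ/16 - θ)`
  have hgap : (2 : ℝ) ≤ M ^ (1 / 2 - δ / 16 - θ) := by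
    have h1 : (m : ℝ) ^ (δ / 16) ≤ M ^ (δ / 16) := Real.rpow_le_rpow hm0R hmM (by positivity)
    have h2 : M ^ (δ / 16) ≤ M ^ (1 / 2 - δ / 16 - θ) :=
      Real.rpow_le_rpow_of_exponent_le hM1 (by linarith)
    linarith
  -- hence `n ≤ M ^ (1/2 - δ/16)`
  have hnM : (n : ℝ) ≤ M ^ (1 / 2 - δ / 16) := by
    calc (n : ℝ) ≤ 2 * M ^ θ := hnhi
      _ ≤ M ^ (1 / 2 - δ / 16 - θ) * M ^ θ := mul_le_mul_of_nonneg_right hgap (by positivity)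
      _ = M ^ (1 / 2 - δ / 16) := by rw [← Real.rpow_add hM0, sub_add_cancel]
  refine ⟨?_, ?_, ?_, ?_⟩
  · -- `n₀ ≤ m ^ (1/3) ≤ m ^ θ ≤ M ^ θ ≤ n`
    have h1 : ((n₀ : ℝ) ^ 3) ^ ((3 : ℕ) : ℝ)⁻¹ ≤ (m : ℝ) ^ ((3 : ℕ) : ℝ)⁻¹ :=
      Real.rpow_le_rpow (by positivity) (by exact_mod_cast hm₀) (by positivity)
    rw [Real.pow_rpow_inv_natCast (Nat.cast_nonneg _) (by norm_num)] at h1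
    have h2 : (m : ℝ) ^ ((3 : ℕ) : ℝ)⁻¹ ≤ (m : ℝ) ^ θ :=
      Real.rpow_le_rpow_of_exponent_le hm1R (by push_cast; linarith)
    have h3 : (m : ℝ) ^ θ ≤ M ^ θ := Real.rpow_le_rpow hm0R hmM hθ0.le
    exact_mod_cast h1.trans (h2.trans (h3.trans hnlo))
  · -- `n ≤ M ^ (1/2 - δ/16) ≤ N`
    have h1 : M ^ (1 / 2 - δ / 16) ≤ N := by rwa [hM, ← Real.rpow_natCast]
    exact_mod_cast hnM.trans h1
  · -- `p ≤ 6^L · M ≤ M ^ (1 + δ/16) = (M ^ θ) ^ (2 + δ) ≤ n ^ (2 + δ)`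
    have h1 : (p : ℝ) ≤ 2 * (3 ^ L * (m : ℝ) ^ L) := by exact_mod_cast hp
    have h2 : (2 : ℝ) * 3 ^ L ≤ 6 ^ L := by
      have h22 : (2 : ℝ) ≤ 2 ^ L := by
        calc (2 : ℝ) = 2 ^ 1 := (pow_one _).symm
          _ ≤ 2 ^ L := pow_le_pow_right₀ one_le_two hL
      calc (2 : ℝ) * 3 ^ L ≤ 2 ^ L * 3 ^ L := mul_le_mul_of_nonneg_right h22 (by positivity)
        _ = 6 ^ L := by rw [← mul_pow]; norm_num
    have h3 : (6 : ℝ) ^ L ≤ M ^ (δ / 16) := by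
      calc (6 : ℝ) ^ L ≤ ((m : ℝ) ^ (δ / 16)) ^ L := pow_le_pow_left₀ (by norm_num) hm6 L
        _ = M ^ (δ / 16) := by
            rw [hM, ← Real.rpow_mul_natCast hm0R, mul_comm, Real.rpow_natCast_mul hm0R]
    have h4 : (p : ℝ) ≤ M ^ (1 + δ / 16) := by
      calc (p : ℝ) ≤ 2 * 3 ^ L * M := by rw [mul_assoc]; exact h1
        _ ≤ M ^ (δ / 16) * M := mul_le_mul_of_nonneg_right (h2.trans h3) hM0.le
        _ = M ^ (1 + δ / 16) := by rw [add_comm, Real.rpow_add_one hM0.ne']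
    have h5 : M ^ (1 + δ / 16) = (M ^ θ) ^ (2 + δ) := by
      rw [← Real.rpow_mul hM0.le]
      congr 1
      rw [hθ, div_mul_cancel₀ _ h2δ.ne']
    rw [h5] at h4
    exact h4.trans (Real.rpow_le_rpow (Real.rpow_nonneg hM0.le _) hnlo h2δ.le)
  · -- `n ^ (2-δ) ≤ M ^ ((1/2 - δ/16)(2 - δ)) ≤ M ^ (1 - δ/16) = (m ^ (1 - δ/16)) ^ L`
    have hexp : (1 / 2 - δ / 16) * (2 - δ) ≤ 1 - δ / 16 := by nlinarith
    calc (n : ℝ) ^ (2 - δ) ≤ (M ^ (1 / 2 - δ / 16)) ^ (2 - δ) :=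
          Real.rpow_le_rpow (Nat.cast_nonneg _) hnM (by linarith)
      _ = M ^ ((1 / 2 - δ / 16) * (2 - δ)) := (Real.rpow_mul hM0.le _ _).symm
      _ ≤ M ^ (1 - δ / 16) := Real.rpow_le_rpow_of_exponent_le hM1 hexp
      _ = ((m : ℝ) ^ (1 - δ / 16)) ^ L := by
          rw [hM, ← Real.rpow_natCast_mul hm0R, mul_comm, Real.rpow_mul_natCast hm0R]

/-- The explicit gadget-level threshold: `m ≥ ⌈6^{16/δ}⌉₊` gives `6 ≤ m^{δ/16}` (for `δ > 0`). -/
theorem capacityTransferK22_six_le {δ : ℝ} (hδ : 0 < δ) {m : ℕ} (hm : ⌈(6 : ℝ) ^ (16 / δ)⌉₊ ≤ m) :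
    (6 : ℝ) ≤ (m : ℝ) ^ (δ / 16) := by
  have h1 : (6 : ℝ) ^ (16 / δ) ≤ m := (Nat.le_ceil _).trans (by exact_mod_cast hm)
  calc (6 : ℝ) = ((6 : ℝ) ^ (16 / δ)) ^ (δ / 16) := by
        rw [← Real.rpow_mul (by norm_num), div_mul_div_comm, mul_comm (16 : ℝ) δ,
          div_self (by positivity), Real.rpow_one]
    _ ≤ (m : ℝ) ^ (δ / 16) := Real.rpow_le_rpow (by positivity) h1 (by positivity)

/-! ## The registered stub -/

/-- **Stub `stub_capacityTransfer` (explicit route): capacity gadgets give every slice `0 < δ ≤ 1` of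
the crux.**  If for every `ε > 0` there are arbitrarily large `m`, a gadget of direct pairs
`(P c, Q c)_{c<r}` in `ℤ/m` (clause (W) letterwise) with co-volumes `|P c||Q c| ≥ m^{1-ε}`, and a
zero-error code `W` of words `Fin L → Fin r`, `L ≥ 1` (every ordered pair of distinct words strongly
separated in some coordinate: the cross differences `Q (k t) - P (i t)` avoid all diagonal difference
sets `Q c - P c`) with `|W| ≥ (m^L)^{1/2-ε}`, then `PrimeTwoFamiliesAt δ`.  Proof with explicit
parameters: `ε := δ/16`, level `m ≥ max (n₀³) ⌈6^{16/δ}⌉₊`, enumerate `W` by `Fin |W|` and lift it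
(tree `CapacityLift.codeLift`) to `|W|` SDPP blocks `∏ₜ P (w t)`, `∏ₜ Q (w t)` in `Fin L → ℤ/m` of
co-volume `≥ (m^{1-ε})^L`; move them with sizes kept into a prime `p ≤ 2·3^L·m^L` (tree
`Theorems.exists_prime_sdpp_of_addEquiv`, `k = L` cyclic factors `ℤ/m`, `AddEquiv.refl`); keep the
first `n := ⌈(m^L)^{(1+δ/16)/(2+δ)}⌉₊` blocks (`capacityTransferK22_bookkeeping`). -/
theorem stub_capacityTransfer
    (h : ∀ ε : ℝ, 0 < ε → ∀ m₀ : ℕ, ∃ m ≥ m₀, ∃ r L : ℕ, ∃ P Q : Fin r → Finset (ZMod m),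
      ∃ W : Finset (Fin L → Fin r),
        (∀ c : Fin r, ∀ x ∈ P c, ∀ x' ∈ P c, ∀ y ∈ Q c, ∀ y' ∈ Q c,
            (x - x') + (y - y') = 0 → x = x' ∧ y = y') ∧
        (∀ i ∈ W, ∀ k ∈ W, i ≠ k → ∃ t : Fin L,
            ∀ x ∈ P (i t), ∀ y ∈ Q (k t), ∀ c : Fin r, ∀ x' ∈ P c, ∀ y' ∈ Q c, y - x ≠ y' - x') ∧
        1 ≤ L ∧ ((m : ℝ) ^ (L : ℝ)) ^ (1 / 2 - ε) ≤ (W.card : ℝ) ∧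
        ∀ c : Fin r, (m : ℝ) ^ (1 - ε) ≤ (((P c).card * (Q c).card : ℕ) : ℝ))
    {δ : ℝ} (hδ : 0 < δ) (hδ1 : δ ≤ 1) : PrimeTwoFamiliesAt δ := by
  classical
  intro n₀
  -- the gadget at the explicit level `m ≥ max (n₀ ^ 3) ⌈6 ^ (16/δ)⌉₊`, with `ε = δ/16`
  obtain ⟨m, hm, r, L, P, Q, W, hD, hC, hL, hWcard, hPQ⟩ :=
    h (δ / 16) (by positivity) (max (n₀ ^ 3) ⌈(6 : ℝ) ^ (16 / δ)⌉₊)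
  have hm₀ : n₀ ^ 3 ≤ m := le_trans (le_max_left _ _) hm
  have hm6 : (6 : ℝ) ≤ (m : ℝ) ^ (δ / 16) :=
    capacityTransferK22_six_le hδ (le_trans (le_max_right _ _) hm)
  have hm1 : 1 ≤ m :=
    le_trans (Nat.ceil_pos.2 (by positivity)) (le_trans (le_max_right _ _) hm)
  -- the code, enumerated by `Fin N`
  set N : ℕ := W.card with hN
  let e : W ≃ Fin N := W.equivFin
  -- the lifted family
  let A : Fin N → Finset (Fin L → ZMod m) :=
    fun i => Fintype.piFinset (fun t => P ((e.symm i : Fin L → Fin r) t))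
  let B : Fin N → Finset (Fin L → ZMod m) :=
    fun i => Fintype.piFinset (fun t => Q ((e.symm i : Fin L → Fin r) t))
  obtain ⟨hW1, hX1⟩ := codeLift P Q hD W hC
  have hWA : ∀ i : Fin N, ∀ a ∈ A i, ∀ a' ∈ A i, ∀ b ∈ B i, ∀ b' ∈ B i,
      (a - a') + (b - b') = 0 → a = a' ∧ b = b' :=
    fun i => hW1 _ (e.symm i).2
  have hXA : ∀ i j k : Fin N, ∀ a ∈ A i, ∀ a' ∈ A j, ∀ b ∈ B j, ∀ b' ∈ B k,
      (a - a') + (b - b') = 0 → i = k := by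
    intro i j k a ha a' ha' b hb b' hb' h0
    have hik := hX1 _ (e.symm i).2 _ (e.symm j).2 _ (e.symm k).2 a ha a' ha' b hb b' hb' h0
    exact e.symm.injective (Subtype.ext hik)
  -- transfer into a prime cyclic host (tree: carry-free mixed-radix map + Bertrand)
  obtain ⟨p, hp, hpR, A', B', hcard, hW', hX'⟩ :=
    exists_prime_sdpp_of_addEquiv hWA hXA (m := fun _ : Fin L => m) (fun _ => hm1)
      (AddEquiv.refl (Fin L → ZMod m))
  rw [Fin.prod_const] at hpR
  -- the explicit number of pairs kept
  obtain ⟨hn₀, hnN, hpn, hnP⟩ :=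
    capacityTransferK22_bookkeeping hδ hδ1 hm₀ hm6 hL hWcard hpR
      (n := ⌈((m : ℝ) ^ L) ^ ((1 + δ / 16) / (2 + δ))⌉₊) rfl
  refine ⟨_, hn₀, p, hp, A' ∘ Fin.castLE hnN, B' ∘ Fin.castLE hnN, ?_, ?_, hpn, ?_⟩
  · intro i
    exact hW' (Fin.castLE hnN i)
  · intro i j k a ha a' ha' b hb b' hb' h0
    exact Fin.castLE_injective hnN (hX' _ _ _ a ha a' ha' b hb b' hb' h0)
  · intro i
    have hci := hcard (Fin.castLE hnN i)
    simp only [Function.comp_apply]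
    rw [hci.1, hci.2]
    simp only [A, B, Fintype.card_piFinset]
    rw [← Finset.prod_mul_distrib]
    refine hnP.trans ?_
    rw [← Fin.prod_const]
    push_cast
    refine Finset.prod_le_prod (fun t _ => by positivity) fun t _ => ?_
    exact_mod_cast hPQ _

end Summit.MatrixMultiplication.MatrixMultiplication.Theorems.PrimeTwoFamilies.CapacityTransferK22
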